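import Summits.CriticalPhenomena.CardyFormulaZ2.Theorems.CardyComplexConeEdgePrecompactUFRSJunctionDeepPair
import Summits.CriticalPhenomena.CardyFormulaZ2.Theorems.CardyComplexConeEdgePrecompactUFRSJunctionGateProb
import Summits.CriticalPhenomena.CardyFormulaZ2.Theorems.CardyComplexConeEdgePrecompactUFRSJunctionScaleOfGate

/-!
# UFRS on rectangles: the junction two-strand decay HJ follows from the funnel alone
(line `qkz-strip-boundary-arm` of crux `CardyComplexCone.EdgePrecompact`, stmt-CriticalPhenomena-11387;
status file of the registered bridge HJ = `ufrs_rect_junctionTwoStrandDecay`, lead c5 wave 3;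
registered anchor `ufrs_rect_junctionTwoStrandDecay_of_funnel`)

**Theorem** (`ufrs_rect_junctionTwoStrandDecay_of_funnel`): S2 → HJ, where S2 = `ufrs_junctionFunnel`
(registered, stated inline: on the junction gate no two corner-disjoint strands cross `A(m; r, K r)`)
and HJ = `ufrs_rect_junctionTwoStrandDecay` VERBATIM (`P(ufrsStrands E w m 2 s S) ≤ C (s/S)^β` at the
marked points of admissible rectangle data). This records the state of the bridge after wave 3:
of the decomposition HJ ⇐ HJ-S (`ufrs_rect_junctionTwoStrandDecay_of_scale`, landed) ⇐ S1 ∧ S2 ∧ S0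
(`ufrs_junction_scale_le_of_gate`, landed), the gate probability S1 (`ufrs_junctionGate_prob`) and
the deep double-junction bound S0 (`ufrs_junction_deepPair_le`) are landed, so ONLY the
deterministic funnel S2 remains.

References: H. Kesten, Comm. Math. Phys. 109 (1987), §2; S. Smirnov, C. R. Acad. Sci. Paris 333
(2001), §2; G. Grimmett, *Percolation* (1999), §11.7–11.8.
-/

namespace Summit.CriticalPhenomena.CardyFormulaZ2.Cruxes.EdgePrecompact.QkzStripBoundaryArm

open MeasureTheory Filter Set Metric
open scoped Topology BigOperators Pointwise
open Literature.Probability.LatticeModels Literature.Probability.Percolation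
open Literature.Probability.RandomPlanarGeometry (DobrushinDomain)
open Summit.CriticalPhenomena.CardyFormulaZ2.Theses.CardyComplexCone

noncomputable section

/-- **HJ from the funnel alone** (registered anchor `ufrs_rect_junctionTwoStrandDecay_of_funnel` of
stmt-CriticalPhenomena-11387): the registered bridge `ufrs_rect_junctionTwoStrandDecay`, verbatim,
from the registered funnel `ufrs_junctionFunnel` (stated inline), by the landed assembly
`ufrs_rect_junctionTwoStrandDecay_of_scale ∘ ufrs_junction_scale_le_of_gate` fed with the landed
`ufrs_junctionGate_prob` (S1) and `ufrs_junction_deepPair_le` (S0). -/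
theorem ufrs_rect_junctionTwoStrandDecay_of_funnel : (∀ (N₀ : ℕ) (E : DiscreteDobrushin) (x₀ x₁ y₀ y₁ : ℝ), x₀ < x₁ → y₀ < y₁ → E.Ω = Set.Ioo x₀ x₁ ×ℂ Set.Ioo y₀ y₁ → E.IsZdAdmissible → ∀ (w : Site 2) (η : ℝ), ‖meshPoint E.δ w‖ < η → ∀ e₀ : Sym2 (Site 2), (e₀ ∈ E.zdABEdges ∨ e₀ ∈ (shiftData E w).zdABEdges) → ∀ (r K : ℝ), 16 ≤ K → K * η ≤ r → 64 * E.δ ≤ r → 2 * (N₀ : ℝ) * E.δ ≤ r → 16 * (K * r) ≤ min (x₁ - x₀) (y₁ - y₀) → (∀ e : Sym2 (Site 2), (e ∈ E.zdABEdges ∨ e ∈ (shiftData E w).zdABEdges) → dist (medialPoint E.δ e) (medialPoint E.δ e₀) ≤ r / K ∨ K * r ≤ dist (medialPoint E.δ e) (medialPoint E.δ e₀)) → (∃ e : Sym2 (Site 2), (e ∈ E.zdABEdges ∨ e ∈ (shiftData E w).zdABEdges) ∧ K * r ≤ dist (medialPoint E.δ e) (medialPoint E.δ e₀)) → (∀ q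 : ℂ, (q.re = x₀ ∨ q.re = x₁) → (q.im = y₀ ∨ q.im = y₁) → dist q (medialPoint E.δ e₀) ≤ r / K ∨ K * r ≤ dist q (medialPoint E.δ e₀)) → ∃ (φ : zdGraph 2 ≃g zdGraph 2) (corner : Bool) (N h : ℕ), N₀ ≤ N ∧ h ≤ N ∧ ∀ ω : BondConfig (Site 2), ω ∈ ufrsJunctionGate φ corner N h → ω ∉ ufrsStrands E w (medialPoint E.δ e₀) 2 r (K * r)) → ∀ (D : DobrushinDomain), (∃ x₀ x₁ y₀ y₁ : ℝ, x₀ < x₁ ∧ y₀ < y₁ ∧ D.carrier = Set.Ioo x₀ x₁ ×ℂ Set.Ioo y₀ y₁) → ∃ C β : ℝ, 0 < C ∧ 0 < β ∧ ∃ η₀ > (0:ℝ), ∀ η : ℝ, 0 < η → η < η₀ → ∃ δ₀ > (0:ℝ), ∀ E : DiscreteDobrushin, E.Ω = D.carrier → E.IsZdAdmissible → E.δ < δ₀ → ∀ w : Site 2, ‖meshPoint E.δ w‖ < η → ∀ e₀ : Sym2 (Site 2), (e₀ ∈ E.zdABEdges ∨ e₀ ∈ (shiftData E w).zdABEdges)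 → ∀ s S : ℝ, η ≤ s → 0 < S → (bondPercolation (zdGraph 2) half).real (ufrsStrands E w (medialPoint E.δ e₀) 2 s S) ≤ C * (s / S) ^ β :=
  fun hS2 => ufrs_rect_junctionTwoStrandDecay_of_scale
    (ufrs_junction_scale_le_of_gate ufrs_junctionGate_prob hS2 ufrs_junction_deepPair_le)

end

end Summit.CriticalPhenomena.CardyFormulaZ2.Cruxes.EdgePrecompact.QkzStripBoundaryArm
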